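/-
Copyright (c) 2026. Released under the Apache 2.0 license.
-/
import Literature.NumberTheory.EllipticCurves.ManinConstantGamma1Gamma0Comparison
import Literature.NumberTheory.Automorphic.ShimuraCurveRibetTakahashiOptimalModularityProofs
import Literature.NumberTheory.EllipticCurves.CuspFormLFunctionLevelConductorProofs
import HarnessLib

/-!
# Stevens' `X₁(N)`-optimal Manin constant: the printed `Γ₁(n)` statements WITHOUT an auxiliary
# `X₀(N)`-datum (the `X₀(N)`-optimal member of the class is supplied by Modularity)

[Proofs] Theorems only (no definition, no named fact). Topic `Literature/NumberTheory/EllipticCurves`;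
namespace `Literature.NumberTheory.EllipticCurves.ModularForms` (typing layer D-0088(4), seat
bsd-littype-12; paper of record Česnavičius–Neururer–Saha, J. Eur. Math. Soc. 26 (2024) 573–637).

`ManinConstantGamma1Gamma0Comparison.lean` proves the printed uses of ČNS Lemma 6.5
(`cesnaviciusNeururerSaha_lemma_6_5_dvd`: the `X₁(N)`-optimal constant divides the `X₀(N)`-optimal
one) for an optimal `X₁(N)`-datum `D₁` of `W₁` GIVEN an optimal `X₀(N)`-datum `D₀` of an isogenous
globally minimal `W₀` as an explicit hypothesis ("exists by modularity in print"). Here that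
hypothesis is DISCHARGED: by the Modularity theorem in the tree's form `exists_isNewformOf`, every
isogeny class has a globally minimal member carrying a lattice-optimal `X₀(N)`-datum at the conductor
level (`Literature.NumberTheory.Automorphic.exists_optimal_modularParametrizationData_of_modularity`,
Pasten's optimal quotient `A_{1,N}` + Edixhoven's `c ∈ ℤ` (a tree theorem) + minimal degree ⟹
lattice clause `ModularParametrizationData.latticeEq_of_forall_modularDegree_le`), and the level of
an `X₁(N)`-datum is the conductor by strong multiplicity one
(`IsNewformOf.level_eq_conductorNorm_of_exists_isNewformOf`). Results, all for an OPTIMAL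
`X₁(N)`-datum `D₁` (`D₁.IsOptimal`, "`Ker(J₁(N) ↠ E)` connected" — Stevens' curve) of a globally
minimal `W₁`:

* `Gamma1ParametrizationData.exists_isIsogenous_optimalDatum` — the `X₀(N)`-optimal member of the
  class at the same level, from `exists_isNewformOf`.
* `cesnavicius2018_not_dvd_maninConstant₁_of_not_sq_dvd_level_of_modularity` — Česnavičius 2018,
  Thm. 1.2 at `H = Γ₁(n)` AS PRINTED: "`p² ∤ n ⟹ ord_p(c_π) = 0`" for the new elliptic optimal
  quotient `π : J₁(n) ↠ E` (modulo the three `Γ₀` named facts `hM`, `hAU`, `hC`, Lemma 6.5 and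
  modularity; no auxiliary datum).
* `abs_maninConstant₁_eq_one_of_squarefree_level` — loc. cit. "In particular, (the Manin conjecture)
  holds in the case when `E` is semistable (i.e., when `n` is squarefree)" at `H = Γ₁(n)`:
  Stevens' `c = ±1` for every semistable class.
* `abs_maninConstant₁_eq_one_of_level_le_500000_of_modularity` — Stevens' `c = ±1` for `N ≤ 500000`
  (Cremona as cited by ČNS §1 p. 574 + fn. 2 "this implies the general case by Lemma 6.5").

## References
* [Cesnavicius2018] K. Česnavičius, *The Manin constant in the semistable case*, Compositio Math.
  154 (2018) 1889–1920 (arXiv:1703.02951), Thm. 1.2 (for `Γ₁(n) ⊂ H ⊂ Γ₀(n)`) and Lemma 2.12.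
* [CesnaviciusNeururerSaha2023] K. Česnavičius, M. Neururer, A. Saha, J. Eur. Math. Soc. 26 (2024),
  §1 p. 574 with fn. 2; Lemma 6.5 (p. 614).
* [BCDTJAMS2001] C. Breuil, B. Conrad, F. Diamond, R. Taylor, J. Amer. Math. Soc. 14 (2001), Thm. A.
-/

noncomputable section

open scoped MatrixGroups ModularForm

open CongruenceSubgroup WeierstrassCurve Literature.NumberTheory.Automorphic

namespace Literature.NumberTheory.EllipticCurves.ModularForms

variable {W₁ : WeierstrassCurve ℚ} [W₁.IsElliptic] [W₁.IsGloballyMinimal] {N : ℕ} [NeZero N]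

/-- **The `X₀(N)`-optimal member of the class, at the level of an `X₁(N)`-datum, from Modularity**:
for a globally minimal `W₁` with an `X₁(N)`-datum `D₁` (so `N = N(W₁)` by strong multiplicity one),
some globally minimal `W₀ ∼ W₁` carries an `X₀(N)`-datum satisfying the lattice clause (the strong
Weil curve; Pasten's `A_{1,N}`, minimal degree ⟹ lattice-optimal). This is the auxiliary datum
`D₀` that `ManinConstantGamma1Gamma0Comparison.lean` takes as a hypothesis.
[cite: BCDTJAMS2001, Thm. A] [cite: CesnaviciusNeururerSaha2023, §1 p. 574 ("any φ factors through
an optimal one")] -/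
theorem Gamma1ParametrizationData.exists_isIsogenous_optimalDatum (hnf : exists_isNewformOf)
    (D₁ : Gamma1ParametrizationData W₁ N) :
    ∃ (W₀ : WeierstrassCurve ℚ) (_ : W₀.IsElliptic) (_ : W₀.IsGloballyMinimal)
      (D₀ : ModularParametrizationData W₀ N),
      IsIsogenous W₁ W₀ ∧ ∀ z ∈ D₀.L.lattice, ∃ w ∈ periodLattice D₀.f, z = D₀.c * w := by
  have hN : N = W₁.conductorNorm ℤ :=
    IsNewformOf.level_eq_conductorNorm_of_exists_isNewformOf hnf D₁.isNewformOf
  obtain ⟨W₀, hE, hM, D₀, -, hiso, hmin⟩ :=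
    exists_optimal_modularParametrizationData_of_modularity hnf N W₁ hN.symm
  haveI := hE
  exact ⟨W₀, hE, hM, D₀, hiso, D₀.latticeEq_of_forall_modularDegree_le hmin⟩

/-- **Česnavičius 2018, Thm. 1.2 at `H = Γ₁(n)`, as printed** ("For an `n ∈ ℤ_{≥1}`, a subgroup
`H ⊂ GL₂(ℤ̂)` with `Γ₁(n) ⊂ H ⊂ Γ₀(n)`, a new elliptic optimal quotient `π : J_H ↠ E`, and a prime
`p`, if `p² ∤ n`, then `ord_p(c_π) = 0`"): for the optimal `X₁(N)`-datum `D₁` of a globally minimal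
curve and a prime `p` with `p² ∤ N`, `p ∤ c(D₁)` — modulo the `Γ₀(n)` case (named facts `hM`
Mazur, `hAU` Abbes–Ullmo, `hC` Česnavičius `2 ∥ n`, assembled by
`cesnavicius2018_not_dvd_maninConstant_of_not_sq_dvd_level`), Lemma 2.12 = ČNS Lemma 6.5 (`h65`)
and Modularity (`hnf`, which supplies the optimal `X₀(N)`-quotient of the class — "The general case
reduces to `Γ₀(n)`"). [cite: Cesnavicius2018, Thm. 1.2 and Prop. 2.13 with Lemma 2.12]
[cite: CesnaviciusNeururerSaha2023, Lemma 6.5 (p. 614)] -/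
theorem cesnavicius2018_not_dvd_maninConstant₁_of_not_sq_dvd_level_of_modularity
    (h65 : cesnaviciusNeururerSaha_lemma_6_5_dvd) (hnf : exists_isNewformOf)
    (hM : mazur_not_dvd_maninConstant_of_odd)
    (hAU : abbesUllmo_not_dvd_maninConstant_of_not_dvd_level)
    (hC : cesnavicius_not_two_dvd_maninConstant_of_two_dvd_level)
    (D₁ : Gamma1ParametrizationData W₁ N) (h₁ : D₁.IsOptimal) {p : ℕ} (hp : p.Prime)
    (hp2 : ¬ p ^ 2 ∣ N) : ¬ (p : ℤ) ∣ D₁.maninConstant := by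
  obtain ⟨W₀, hE, hM₀, D₀, hiso, h₀⟩ := D₁.exists_isIsogenous_optimalDatum hnf
  haveI := hE; haveI := hM₀
  exact cesnavicius2018_not_dvd_maninConstant₁_of_not_sq_dvd_level h65 D₁ D₀ hiso h₁ h₀ hM hAU hC
    hp hp2

/-- Valuation form: `ord_p(c(D₁)) = 0` for `p² ∤ N` (Česnavičius 2018, Thm. 1.2 at `H = Γ₁(n)`).
[cite: Cesnavicius2018, Thm. 1.2] -/
theorem cesnavicius2018_padicValInt_maninConstant₁_eq_zero_of_not_sq_dvd_level_of_modularity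
    (h65 : cesnaviciusNeururerSaha_lemma_6_5_dvd) (hnf : exists_isNewformOf)
    (hM : mazur_not_dvd_maninConstant_of_odd)
    (hAU : abbesUllmo_not_dvd_maninConstant_of_not_dvd_level)
    (hC : cesnavicius_not_two_dvd_maninConstant_of_two_dvd_level)
    (D₁ : Gamma1ParametrizationData W₁ N) (h₁ : D₁.IsOptimal) (p : ℕ) [hp : Fact p.Prime]
    (hp2 : ¬ p ^ 2 ∣ N) : padicValInt p D₁.maninConstant = 0 :=
  padicValInt.eq_zero_of_not_dvd
    (cesnavicius2018_not_dvd_maninConstant₁_of_not_sq_dvd_level_of_modularity h65 hnf hM hAU hC D₁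
      h₁ hp.out hp2)

/-- **Stevens' `c = ±1` for every SEMISTABLE class** (Česnavičius 2018, Thm. 1.2: "In particular,
(the Manin conjecture) holds in the case when `E` is semistable (i.e., when `n` is squarefree)", read
at `H = Γ₁(n)`; ČNS §1 fn. 2): for squarefree `N`, the optimal `X₁(N)`-datum of a globally minimal
curve has `|c| = 1` — modulo `hM`, `hAU`, `hC`, Lemma 6.5 and Modularity.
[cite: Cesnavicius2018, Thm. 1.2 ("In particular …")] [cite: CesnaviciusNeururerSaha2023, §1 fn. 2
(p. 574) and Lemma 6.5 (p. 614)] -/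
theorem abs_maninConstant₁_eq_one_of_squarefree_level
    (h65 : cesnaviciusNeururerSaha_lemma_6_5_dvd) (hnf : exists_isNewformOf)
    (hM : mazur_not_dvd_maninConstant_of_odd)
    (hAU : abbesUllmo_not_dvd_maninConstant_of_not_dvd_level)
    (hC : cesnavicius_not_two_dvd_maninConstant_of_two_dvd_level)
    (D₁ : Gamma1ParametrizationData W₁ N) (h₁ : D₁.IsOptimal) (hsq : Squarefree N) :
    |D₁.maninConstant| = 1 := by
  rw [Int.abs_eq_natAbs, Nat.cast_eq_one]
  by_contra hne
  obtain ⟨p, hp, hpd⟩ := Nat.exists_prime_and_dvd hne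
  have hp2 : ¬ p ^ 2 ∣ N := fun h ↦ by
    rw [pow_two] at h
    exact hp.one_lt.ne' (Nat.isUnit_iff.mp (hsq p h))
  exact cesnavicius2018_not_dvd_maninConstant₁_of_not_sq_dvd_level_of_modularity h65 hnf hM hAU hC
    D₁ h₁ hp hp2 (Int.natCast_dvd.mpr hpd)

/-- **Stevens' `c = ±1` at levels `N ≤ 500000`** (Cremona's verification of the Manin conjecture for
`N ≤ 500000` as cited by ČNS §1 p. 574, transported by fn. 2 / Lemma 6.5), for the optimal
`X₁(N)`-datum of ANY globally minimal curve — modulo the named facts `h65`, `hCre` and Modularity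
(no auxiliary `X₀(N)`-datum). [cite: CesnaviciusNeururerSaha2023, §1 p. 574 with fn. 2, Lemma 6.5
(p. 614)] -/
theorem abs_maninConstant₁_eq_one_of_level_le_500000_of_modularity
    (h65 : cesnaviciusNeururerSaha_lemma_6_5_dvd) (hnf : exists_isNewformOf)
    (hCre : cremona_abs_maninConstant_eq_one_of_level_le_500000)
    (D₁ : Gamma1ParametrizationData W₁ N) (h₁ : D₁.IsOptimal) (hN : N ≤ 500000) :
    |D₁.maninConstant| = 1 := by
  obtain ⟨W₀, hE, hM₀, D₀, hiso, h₀⟩ := D₁.exists_isIsogenous_optimalDatum hnf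
  haveI := hE; haveI := hM₀
  exact abs_maninConstant₁_eq_one_of_level_le_500000 h65 D₁ D₀ hiso h₁ h₀ hCre hN

end Literature.NumberTheory.EllipticCurves.ModularForms

end
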